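import Summits.ResolutionOfSingularities.ResolutionOfSingularities.Theorems.WildQuotientsWildQuotientResolutionS1aMoveStep

/-!
# S1a — H4d: (R1) an admissible centre is a non-zero ideal sheaf; the MOVE from the chart residue alone
[OURS · L1 W4.5c · idea-2 g15]

NOT a statement of the manuscript; counted 0. AI-level work, weaker than expert review.

Ring core: in a graded ring with (T1) (homogeneous units whose degrees generate a finite-index subgroup `H` of
the grading group), for a homogeneous `f₀` which is a non-zero-divisor, `x := f₀^k · v` with `k = [ι : H]` and
`v` a homogeneous unit of degree `-(k • deg f₀)` is a DEGREE-0 NON-ZERO-DIVISOR lying in `𝒥_{k w₀}(f, w)`; its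
powers meet every `𝒥ₙ`. Hence the degree-0 trace `𝒦ₙ` of H4a contains non-zero-divisors for every `n`
(`exists_mem_traceFiltration_mem_nonZeroDivisors`), an admissible centre of H4b is a non-zero ideal sheaf on an
integral model (`centreNeBot : CentreNeBot p`, PROVED), and the MOVE needs only the chart residue:
**`moveStep_of_blowupNodeAtlas : BlowupNodeAtlas p → MoveStep p`**.

Lemma of independent use: `mem_neg_of_mul_eq_one` — the inverse of a homogeneous unit is homogeneous (any
grading by an additive commutative group, any commutative ring).
-/

set_option linter.dupNamespace false

noncomputable section

open CategoryTheory AlgebraicGeometry TopologicalSpace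
open Literature.AlgebraicGeometry.Resolution Literature.AlgebraicGeometry.RelativeSpec
open Summit.ResolutionOfSingularities.ResolutionOfSingularities.Theorems.WildQuotientResolution.S1
open Summit.ResolutionOfSingularities.ResolutionOfSingularities.Theorems.WildQuotientResolution.S1.NodeAtlas
open Summit.ResolutionOfSingularities.ResolutionOfSingularities.Theorems.WildQuotientResolution.S1.MoveStep

namespace Summit.ResolutionOfSingularities.ResolutionOfSingularities.Theorems.WildQuotientResolution.S1.CentreNeBot

universe u v

/-! ## Graded-ring lemmas -/

section Graded

variable {ι : Type v} [AddCommGroup ι] [DecidableEq ι] {B : Type u} [CommRing B] (𝒜 : ι → AddSubgroup B)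
  [GradedRing 𝒜]

/-- **The inverse of a homogeneous unit is homogeneous**, of the opposite degree. -/
theorem mem_neg_of_mul_eq_one {d : ι} {u v : B} (hu : u ∈ 𝒜 d) (huv : u * v = 1) : v ∈ 𝒜 (-d) := by
  classical
  have hcomp : ∀ e : ι, e ≠ -d → (DirectSum.decompose 𝒜 v e : B) = 0 := by
    intro e he
    have h1 : (DirectSum.decompose 𝒜 (u * v) (d + e) : B) = u * DirectSum.decompose 𝒜 v e :=
      DirectSum.coe_decompose_mul_add_of_left_mem 𝒜 hu
    have h2 : (DirectSum.decompose 𝒜 (u * v) (d + e) : B) = 0 := by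
      rw [huv]
      exact DirectSum.decompose_of_mem_ne 𝒜 SetLike.GradedOne.one_mem
        (fun h => he (eq_neg_of_add_eq_zero_right h.symm))
    calc (DirectSum.decompose 𝒜 v e : B) = v * (u * DirectSum.decompose 𝒜 v e) := by
          rw [← mul_assoc, mul_comm v u, huv, one_mul]
      _ = 0 := by rw [← h1, h2, mul_zero]
  have hv : v = (DirectSum.decompose 𝒜 v (-d) : B) := by
    conv_lhs => rw [← DirectSum.sum_support_decompose 𝒜 v]
    rw [Finset.sum_eq_single (-d) (fun e _ hne => hcomp e hne)]
    intro h
    rw [DFinsupp.mem_support_iff, not_not] at h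
    rw [h]
    rfl
  rw [hv]
  exact SetLike.coe_mem _

/-- Under (T1): every degree in the subgroup generated by the unit degrees carries a homogeneous unit. -/
theorem exists_isUnit_mem_of_mem_closure {s : Set ι} (hs : ∀ d ∈ s, ∃ u : B, IsUnit u ∧ u ∈ 𝒜 d) {x : ι}
    (hx : x ∈ AddSubgroup.closure s) : ∃ u : B, IsUnit u ∧ u ∈ 𝒜 x := by
  induction hx using AddSubgroup.closure_induction with
  | mem x hx => exact hs x hx
  | zero => exact ⟨1, isUnit_one, SetLike.GradedOne.one_mem⟩
  | add x y _ _ hx hy =>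
    obtain ⟨u, hu, hux⟩ := hx
    obtain ⟨v, hv, hvy⟩ := hy
    exact ⟨u * v, hu.mul hv, SetLike.GradedMul.mul_mem hux hvy⟩
  | neg x _ hx =>
    obtain ⟨u, hu, hux⟩ := hx
    obtain ⟨v, hv⟩ := hu.exists_right_inv
    refine ⟨v, IsUnit.of_mul_eq_one u ?_, mem_neg_of_mul_eq_one 𝒜 hux hv⟩
    rwa [mul_comm] at hv

/-- Powers in an ideal filtration: `a ∈ 𝒥ₙ ⇒ a^k ∈ 𝒥_{k n}`. -/
theorem pow_mem_ideal_mul {A : Type u} [CommRing A] (F : IdealFiltration A) {a : A} {n : ℕ}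
    (ha : a ∈ F.ideal n) (k : ℕ) : a ^ k ∈ F.ideal (k * n) := by
  induction k with
  | zero => rw [zero_mul, F.ideal_zero]; exact Submodule.mem_top
  | succ k ih =>
    rw [pow_succ, Nat.succ_mul]
    exact F.mul_le (k * n) n (Ideal.mul_mem_mul ih ha)

/-- **(T1) + a homogeneous non-zero-divisor `f₀` of positive weight ⇒ the degree-0 trace `𝒦ₙ` contains a
non-zero-divisor of `B`, for every `n`.** -/
theorem exists_mem_traceFiltration_mem_nonZeroDivisors
    (hT1 : ∃ s : Finset ι, (∀ d ∈ s, ∃ u : B, IsUnit u ∧ u ∈ 𝒜 d) ∧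
      (AddSubgroup.closure (s : Set ι)).FiniteIndex)
    {c : ℕ} (f : Fin c → B) (δ : Fin c → ι) (w : Fin c → ℕ) (i₀ : Fin c) (hf : f i₀ ∈ 𝒜 (δ i₀))
    (hw : 0 < w i₀) (hf0 : f i₀ ∈ nonZeroDivisors B) (n : ℕ) :
    ∃ x ∈ (CoarseChart.traceFiltration 𝒜 f w).ideal n, (x : B) ∈ nonZeroDivisors B := by
  classical
  obtain ⟨s, hs, hfi⟩ := hT1
  set H := AddSubgroup.closure (s : Set ι) with hH
  set k := H.index with hk
  have hk0 : k ≠ 0 := AddSubgroup.FiniteIndex.index_ne_zero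
  have hmem : -(k • δ i₀) ∈ H := H.neg_mem (H.nsmul_index_mem (δ i₀))
  obtain ⟨v, hv, hvdeg⟩ := exists_isUnit_mem_of_mem_closure 𝒜 hs hmem
  -- the degree-0 non-zero-divisor `x = f₀^k v ∈ 𝒥_{k w₀}`
  have hx0 : f i₀ ^ k * v ∈ 𝒜 0 := by
    have := SetLike.GradedMul.mul_mem (SetLike.pow_mem_graded k hf) hvdeg
    rwa [add_neg_cancel] at this
  have hxJ : f i₀ ^ k * v ∈ (weightedFiltration f w).ideal (k * w i₀) :=
    Ideal.mul_mem_right _ _ (pow_mem_ideal_mul (weightedFiltration f w) (mem_weightedFiltration_ideal f w i₀) k)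
  have hxnzd : f i₀ ^ k * v ∈ nonZeroDivisors B := mul_mem (pow_mem hf0 k) hv.mem_nonZeroDivisors
  -- its `n`-th power lies in `𝒥ₙ`
  refine ⟨⟨(f i₀ ^ k * v) ^ n, SetLike.pow_mem_graded n hx0 |> fun h => by rwa [nsmul_zero] at h⟩, ?_,
    pow_mem hxnzd n⟩
  rw [CoarseChart.mem_traceFiltration_iff]
  have hle : n ≤ n * (k * w i₀) := Nat.le_mul_of_pos_right n (Nat.mul_pos (Nat.pos_of_ne_zero hk0) hw)
  exact (weightedFiltration f w).antitone hle (pow_mem_ideal_mul (weightedFiltration f w) hxJ n)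

end Graded

/-! ## (R1) and the move from the chart residue alone -/

/-- In a centre chart the first centre generator is a non-zero-divisor (K1′: `(f)` is a regular sequence). -/
theorem mem_nonZeroDivisors_of_isWeaklyRegular {B : Type u} [CommRing B] {c : ℕ} (f : Fin (c + 1) → B)
    (hreg : RingTheory.Sequence.IsWeaklyRegular B (List.ofFn f)) : f 0 ∈ nonZeroDivisors B := by
  rw [List.ofFn_succ, RingTheory.Sequence.isWeaklyRegular_cons_iff] at hreg
  refine mem_nonZeroDivisors_iff_right.2 fun x hx => hreg.1 ?_
  change f 0 • x = f 0 • (0 : B)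
  rw [smul_eq_mul, smul_zero, mul_comm, hx]

/-- **(R1) PROVED**: an admissible centre on an integral model is a non-zero ideal sheaf. -/
theorem centreNeBot (p : ℕ) : CentreNeBot.{u} p := by
  intro V Y q G _ ρ g₀ 𝒦 d hV h𝒦 hbot
  classical
  obtain ⟨v⟩ := hV.nonempty
  obtain ⟨O, hvO, hcentre | hidle⟩ := h𝒦.2.2 v
  swap
  · -- idle chart: `𝒦_d(O) = ⊤ ∋ 1 ≠ 0`
    obtain ⟨hchart, hunit⟩ := hidle
    haveI : Nonempty ↥(O.1) := ⟨⟨v, hvO⟩⟩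
    have h1 : (1 : Γ(V, O.1)) ∈ (𝒦.ideal d).ideal ⟨O.1, hchart.1⟩ := by
      change (1 : Γ(V, O.1)) ∈ (𝒦.filtration ⟨O.1, hchart.1⟩).ideal d
      rw [hunit d]; exact Submodule.mem_top
    rw [hbot, Scheme.IdealSheafData.ideal_bot] at h1
    exact one_ne_zero (h1 : (1 : Γ(V, O.1)) = 0)
  obtain ⟨hO, m, r, B, _, 𝒜, _, σ, e, hnode, -, c, f, δ, w, hc, hf, hw, hreg, -, -, htrace, -⟩ := hcentre
  obtain ⟨c, rfl⟩ := Nat.exists_eq_succ_of_ne_zero hc.ne'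
  obtain ⟨x, hx, hxnzd⟩ := exists_mem_traceFiltration_mem_nonZeroDivisors 𝒜 hnode.2.2.1 f δ w 0 (hf 0) (hw 0)
    (mem_nonZeroDivisors_of_isWeaklyRegular f hreg.toIsWeaklyRegular) d
  -- transport to a section of `𝒦_d` over `O`
  have hsec : e.symm x ∈ (𝒦.ideal d).ideal ⟨O.1, hO⟩ := by
    have h1 : e.symm x ∈ ((CoarseChart.traceFiltration 𝒜 f w).ideal d).comap (e : Γ(V, O.1) →+* ↥(𝒜 0)) := by
      rw [Ideal.mem_comap]
      change e (e.symm x) ∈ _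
      rwa [e.apply_symm_apply]
    rw [← htrace d] at h1
    exact h1
  rw [hbot, Scheme.IdealSheafData.ideal_bot] at hsec
  have hx0 : e.symm x = 0 := hsec
  -- but `x ≠ 0`: it is a non-zero-divisor of the nontrivial ring `B`
  haveI : Nonempty ↥(O.1) := ⟨⟨v, hvO⟩⟩
  haveI : Nontrivial Γ(V, O.1) := inferInstance
  haveI : Nontrivial ↥(𝒜 0) := e.injective.nontrivial
  haveI : Nontrivial B := Subtype.val_injective.nontrivial (α := ↥(𝒜 0))
  have hxne : (x : B) ≠ 0 := nonZeroDivisors.ne_zero hxnzd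
  apply hxne
  have : x = 0 := e.symm.injective (by rw [hx0, map_zero])
  rw [this]
  rfl

/-- **THE MOVE from the chart residue alone**: `BlowupNodeAtlas p → MoveStep p`. -/
theorem moveStep_of_blowupNodeAtlas {p : ℕ} (hcharts : BlowupNodeAtlas.{u} p) : MoveStep.{u} p :=
  moveStep_of hcharts (centreNeBot p)

end Summit.ResolutionOfSingularities.ResolutionOfSingularities.Theorems.WildQuotientResolution.S1.CentreNeBot

end
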